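import Literature.AlgebraicGeometry.ModuliOfAbelianVarieties.SiegelFamilyRealLocusGenericPoints
import Literature.LinearAlgebra.Matrix.SpecialLinearReductionSurjective
import HarnessLib

/-!
# Goresky–Tai's Lemma 9 (3) — `τ(g)g⁻¹ ∈ Γ(4m) ⟹ g = βu`, `β ∈ Γ_{2m}(2)`, `u ∈ GL(g, ℤ)` — and
# COROLLARY 11 as printed: `γ ∈ Γ(4m)`, `𝔥_g^γ ≠ ∅ ⟹ γ = τ(β)β⁻¹` with `β ∈ Γ_{2m}(2)` (hence `𝔥_g^γ = β · iC_g`)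
# (Goresky–Tai 2003, §4.1 (`Γ_{2m}(2)`), §4.3 Lemma 9 (3) with its converse, equation (4.3), §4.4 Cor. 11)

Topic `Literature/AlgebraicGeometry/ModuliOfAbelianVarieties` (the Siegel-family files, namespace
`Literature.AlgebraicGeometry.ModuliOfAbelianVarieties.SiegelModuli`).  Lane `lit-hodgefound` (Track 2
foundations library), prover seat p15 generation 52, row g52-#4, on top of g52-#3
`SiegelFamilyRealLocusGenericPoints` (a `Γ(4m)`-element with a real point is `τ(h)h⁻¹` with `h ∈ Sp_{2g}(ℤ)`)
and the tree's `LinearAlgebra/Matrix/SpecialLinearReductionSurjective` (`SL_g(ℤ) → SL_g(ℤ/N)` is onto —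
used at `N = 2`, where `GL_g(ℤ/2) = SL_g(ℤ/2)`).  THEOREMS ONLY: no definition, no instance, no notation, no
named fact (net Literature debt `0`), no `sorry`.  The group `Γ_{2m}(2)` is not introduced as a `Subgroup`:
its four defining congruences are spelled out on the blocks (`A ≡ D ≡ I (mod 2)`, `B ≡ C ≡ 0 (mod 2m)`) as
reductions to `ZMod 2` / `ZMod (2m)` — the tree's idiom for `Γ(q)` (`mem_siegelPrincipalGamma_iff`).

## Source, VERBATIM

M. Goresky, Y. S. Tai, *The moduli space of real abelian varieties with level structure*, Compositio
Math. **139** (2003) = arXiv:math/0108103, held `paper:arxiv-math_0108103`.  §4.1 p0007: «`Γ(1) = Sp(2n, ℤ)`»,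
«`Γ(N) = {γ ∈ Γ(1) | γ ≡ I (mod N)}`», «`Γ_{2m}(2) = {(A B; C D) ∈ Γ | A, D ≡ I (mod 2), B, C ≡ 0 (mod 2m)}`»,
«`Γ_ℓ(1) = GL(n, ℤ)`».  «**Lemma 9.** Let `g ∈ Sp(2n, ℤ)`.  Fix `m ≥ 1`. (1) If `g ∈ Γ(m)` then `g̃g⁻¹ ∈ Γ(2m)`.
(2) If `g ∈ Γ(2m)` then `g̃g ∈ Γ(4m)`.  (3) If `g̃g⁻¹ ∈ Γ(4m)` then `g = βu` for some `β ∈ Γ_{2m}(2)` and for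
some `u ∈ GL(n, ℤ)`.  4.3 Proof.  Let `g = (A B; C D)`.  Since `g̃ = g − (0 2B; 2C 0)` we have
(4.3) `g̃g⁻¹ = I − (−2BᵗC 2BᵗA; 2CᵗD −2CᵗA)`. … Now suppose that `g̃g⁻¹ ∈ Γ(4m)` so that
`BᵗC ≡ BᵗA ≡ CᵗD ≡ 0 (mod 2m)`.  Then `B = B(ᵗAD − ᵗCB) = (BᵗA)D − (BᵗC)B ≡ 0 (mod 2m)`,
`ᵗC = (ᵗAD − ᵗCB)ᵗC = ᵗA(DᵗC) − ᵗC(BᵗC) ≡ 0 (mod 2m)`.» p0008: «Moreover, since `CᵗB ≡ 0 (mod (2m))` and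
`AᵗD − BᵗC = I` we see that `AᵗD ≡ I (mod 2)`.  Hence `A` is invertible `(mod 2)`.  But reduction `(mod 2)` is a
surjective mapping `GL(n, ℤ) → GL(n, ℤ/(2))` hence there exists `U ∈ GL(n, ℤ)` so that `U ≡ A (mod 2)` from
which it also follows that `U⁻¹ ≡ ᵗD (mod 2)`.  Let `u = (U 0; 0 ᵗU⁻¹) ∈ Sp`.  Then `β = gu⁻¹ = (AU⁻¹ BᵗU;
CU⁻¹ DᵗU)` is in `Γ_{2m}(2)` as claimed.  Conversely, if `β ∈ Γ_{2m}(2)` and `u ∈ GL(n, ℤ)` then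
`τ(βu)(βu)⁻¹ = β̃β⁻¹` which is easily seen (using (4.3)) to lie in `Γ(4m)`.»  «**Corollary 11.** Suppose
`γ ∈ Γ(4m)` and `𝔥_n^γ ≠ ∅`.  Then there exists `g ∈ Γ_{2m}(2)` such that `γ = g̃g⁻¹` (hence `𝔥_n^γ = giC_n`).
4.4 Proof. … By Proposition 10, there exists `h ∈ Sp(2n, ℤ)` so that `γ = h̃h⁻¹`.  By Lemma 9 this implies
that `h = βu` for some `β ∈ Γ_{2m}(2)` and some `u ∈ GL(n, ℤ)`.  Hence `γ = h̃h⁻¹ = β̃β⁻¹` as claimed.»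

## What is proved (`K = (−1 0; 0 1)` integral, `τ(g) = g̃ = KgK`; blocks `A = g₁₁`, `B = g₁₂`, `C = g₂₁`, `D = g₂₂`)

* §1 `coe_inv_eq_fromBlocks` (`g⁻¹ = (ᵗD −ᵗB; −ᵗC ᵗA)`, (2.1)), the symplectic block identities in both
  transposed forms, **`conjK_mul_coe_inv_eq_fromBlocks`** — equation (4.3):
  `τ(g)g⁻¹ = (1 + 2BᵗC, −2BᵗA; −2CᵗD, 1 + 2CᵗB)` (the printed lower-right entry `−2CᵗA` of the bracket is a
  misprint for `−2CᵗB = −ᵗ(2BᵗC)`: e.g. `g = (2 1; 1 1) ∈ SL₂(ℤ) = Sp₂(ℤ)` has `g̃g⁻¹ = (3 −4; −2 3)`,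
  lower-right `3 = 1 + 2CᵗB ≠ 1 + 2CᵗA = 5`; immaterial to the proof, which uses the other three blocks),
  `map_two_smul_eq_zero_iff` (`2X ≡ 0 (mod 4m) ⟺ X ≡ 0 (mod 2m)`).
* §2 `fromBlocks_specialLinearGroup_mem_symplecticGroup` (`(U 0; 0 ᵗU⁻¹) ∈ Sp_{2g}(ℤ)`),
  **`exists_eq_mul_fromBlocks_of_conjK_mul_inv_mem_siegelPrincipalGamma`** — LEMMA 9 (3): `τ(g)g⁻¹ ∈ Γ(4m)`
  ⟹ `g = βu`, `β ∈ Γ_{2m}(2)` (the four block congruences), `u = (U 0; 0 ᵗU⁻¹)` with `U ∈ SL(g, ℤ)` (so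
  `u ∈ GL(g, ℤ) ↪ Sp`); stated for every `m` (for `m = 0`, `Γ(0) = {1}` and the congruences `mod 0` are equalities).
* §3 the converse: `conjK_mul_inv_mem_siegelPrincipalGamma_of_toBlocks` (`B ≡ C ≡ 0 (mod 2m) ⟹ τ(β)β⁻¹ ∈ Γ(4m)`),
  `conjK_mul_inv_mul_eq_of_coe_eq_fromBlocks` (`τ(βu)(βu)⁻¹ = τ(β)β⁻¹` for block-diagonal symplectic `u`, i.e.
  `u` in the embedded `GL(g, ℤ)`), `conjK_mul_inv_mem_siegelPrincipalGamma_of_toBlocks_of_coe_eq_fromBlocks` (both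
  combined, as printed).
* §4 **`exists_gammaTwoM_eq_conjK_mul_inv_of_mem_siegelPrincipalGamma_four_mul`** — COROLLARY 11 as printed
  (`g ≥ 1`, `m ≥ 1`): `γ ∈ Γ_g(4m)` with `𝔥_g^γ ≠ ∅ ⟹ ∃ β ∈ Γ_{2m}(2)`, `γ = τ(β)β⁻¹` in `Sp_{2g}(ℤ)`, and
  `𝔥_g^γ = β · iC_g` (`γ • Ω = τΩ ⟺ Re(β⁻¹ • Ω) = 0`).

## References

* [GoreskyTai2003RealModuli] M. Goresky, Y. S. Tai, Compositio Math. 139 (2003) 1–27 (arXiv:math/0108103),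
  §2.1 (2.1), §4.1, §4.3 Lemma 9 and (4.3), §4.4 Cor. 11.
* [AndrianovZhuravlev2015] A. N. Andrianov, V. G. Zhuravlev, *Modular Forms and Hecke Operators*, Chap. 2 §2.1
  (2.1) (`Γⁿ(q)`), Chap. 3 Lemma 3.2 (1) (`SL_n(ℤ) → SL_n(ℤ/q)` onto).
-/

noncomputable section

open scoped Matrix ComplexConjugate
open Matrix Function

namespace Literature.AlgebraicGeometry.ModuliOfAbelianVarieties

namespace SiegelModuli

open Literature.NumberTheory.Automorphic (siegelUpperHalfSpace)
open Literature.NumberTheory.ModularForms.SiegelUpperHalfSpace (symplecticIntHom siegelModularGroup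
  symplecticIntHom_injective)
open Literature.NumberTheory.ModularForms.SiegelModularForm (siegelPrincipalGamma mem_siegelPrincipalGamma_iff)
open Literature.LinearAlgebra.Matrix.IntegerSpecialLinear (exists_specialLinearGroup_map_intCast_eq)

variable {g : ℕ}

/-! ## §1 Block formulas: `g⁻¹`, the symplectic identities, `τ(g)g⁻¹` (equation (4.3)), halving a congruence -/

/-- `g⁻¹ = (ᵗD −ᵗB; −ᵗC ᵗA)` for symplectic `g = (A B; C D)` (over any commutative ring).
[cite: GoreskyTai2003RealModuli, §2.1 (2.1)] -/
theorem coe_inv_eq_fromBlocks {R : Type*} [CommRing R] (γ : Matrix.symplecticGroup (Fin g) R) :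
    ((γ⁻¹ : Matrix.symplecticGroup (Fin g) R) : Matrix (Fin g ⊕ Fin g) (Fin g ⊕ Fin g) R) =
      Matrix.fromBlocks (γ : Matrix (Fin g ⊕ Fin g) (Fin g ⊕ Fin g) R).toBlocks₂₂ᵀ
        (-(γ : Matrix (Fin g ⊕ Fin g) (Fin g ⊕ Fin g) R).toBlocks₁₂ᵀ)
        (-(γ : Matrix (Fin g ⊕ Fin g) (Fin g ⊕ Fin g) R).toBlocks₂₁ᵀ)
        (γ : Matrix (Fin g ⊕ Fin g) (Fin g ⊕ Fin g) R).toBlocks₁₁ᵀ := by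
  rw [SymplecticGroup.coe_inv]
  conv_lhs => rw [← Matrix.fromBlocks_toBlocks (γ : Matrix (Fin g ⊕ Fin g) (Fin g ⊕ Fin g) R)]
  rw [Matrix.J, Matrix.fromBlocks_transpose, Matrix.fromBlocks_neg, Matrix.fromBlocks_multiply,
    Matrix.fromBlocks_multiply]
  simp

/-- The symplectic identities of `g = (A B; C D)` in the form `AᵗB = BᵗA`, `CᵗD = DᵗC`, `AᵗD − BᵗC = 1`
(i.e. `ᵗg ∈ Sp`). [cite: GoreskyTai2003RealModuli, §2.1 and §4.3 («`AᵗD − BᵗC = I`»)] -/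
theorem toBlocks_mul_transpose_rel {R : Type*} [CommRing R] (γ : Matrix.symplecticGroup (Fin g) R) :
    (γ : Matrix (Fin g ⊕ Fin g) (Fin g ⊕ Fin g) R).toBlocks₁₁ * (γ : Matrix (Fin g ⊕ Fin g) (Fin g ⊕ Fin g) R).toBlocks₁₂ᵀ =
        (γ : Matrix (Fin g ⊕ Fin g) (Fin g ⊕ Fin g) R).toBlocks₁₂ * (γ : Matrix (Fin g ⊕ Fin g) (Fin g ⊕ Fin g) R).toBlocks₁₁ᵀ ∧
      (γ : Matrix (Fin g ⊕ Fin g) (Fin g ⊕ Fin g) R).toBlocks₂₁ * (γ : Matrix (Fin g ⊕ Fin g) (Fin g ⊕ Fin g) R).toBlocks₂₂ᵀ =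
        (γ : Matrix (Fin g ⊕ Fin g) (Fin g ⊕ Fin g) R).toBlocks₂₂ * (γ : Matrix (Fin g ⊕ Fin g) (Fin g ⊕ Fin g) R).toBlocks₂₁ᵀ ∧
      (γ : Matrix (Fin g ⊕ Fin g) (Fin g ⊕ Fin g) R).toBlocks₁₁ * (γ : Matrix (Fin g ⊕ Fin g) (Fin g ⊕ Fin g) R).toBlocks₂₂ᵀ -
        (γ : Matrix (Fin g ⊕ Fin g) (Fin g ⊕ Fin g) R).toBlocks₁₂ * (γ : Matrix (Fin g ⊕ Fin g) (Fin g ⊕ Fin g) R).toBlocks₂₁ᵀ = 1 := by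
  have hT := SymplecticGroup.transpose_mem γ.2
  rw [← Matrix.fromBlocks_toBlocks (γ : Matrix (Fin g ⊕ Fin g) (Fin g ⊕ Fin g) R), Matrix.fromBlocks_transpose,
    SymplecticGroup.fromBlocks_mem_iff] at hT
  simpa only [Matrix.transpose_transpose] using hT

/-- The symplectic identities of `g = (A B; C D)` in the form `ᵗAC = ᵗCA`, `ᵗBD = ᵗDB`, `ᵗAD − ᵗCB = 1`.
[cite: GoreskyTai2003RealModuli, §2.1 and §4.3 («`B = B(ᵗAD − ᵗCB)`»)] -/
theorem toBlocks_transpose_mul_rel {R : Type*} [CommRing R] (γ : Matrix.symplecticGroup (Fin g) R) :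
    (γ : Matrix (Fin g ⊕ Fin g) (Fin g ⊕ Fin g) R).toBlocks₁₁ᵀ * (γ : Matrix (Fin g ⊕ Fin g) (Fin g ⊕ Fin g) R).toBlocks₂₁ =
        (γ : Matrix (Fin g ⊕ Fin g) (Fin g ⊕ Fin g) R).toBlocks₂₁ᵀ * (γ : Matrix (Fin g ⊕ Fin g) (Fin g ⊕ Fin g) R).toBlocks₁₁ ∧
      (γ : Matrix (Fin g ⊕ Fin g) (Fin g ⊕ Fin g) R).toBlocks₁₂ᵀ * (γ : Matrix (Fin g ⊕ Fin g) (Fin g ⊕ Fin g) R).toBlocks₂₂ =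
        (γ : Matrix (Fin g ⊕ Fin g) (Fin g ⊕ Fin g) R).toBlocks₂₂ᵀ * (γ : Matrix (Fin g ⊕ Fin g) (Fin g ⊕ Fin g) R).toBlocks₁₂ ∧
      (γ : Matrix (Fin g ⊕ Fin g) (Fin g ⊕ Fin g) R).toBlocks₁₁ᵀ * (γ : Matrix (Fin g ⊕ Fin g) (Fin g ⊕ Fin g) R).toBlocks₂₂ -
        (γ : Matrix (Fin g ⊕ Fin g) (Fin g ⊕ Fin g) R).toBlocks₂₁ᵀ * (γ : Matrix (Fin g ⊕ Fin g) (Fin g ⊕ Fin g) R).toBlocks₁₂ = 1 := by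
  have h := γ.2
  rw [← Matrix.fromBlocks_toBlocks (γ : Matrix (Fin g ⊕ Fin g) (Fin g ⊕ Fin g) R), SymplecticGroup.fromBlocks_mem_iff] at h
  exact h

/-- **Equation (4.3)**: `τ(g)g⁻¹ = (1 + 2BᵗC, −2BᵗA; −2CᵗD, 1 + 2CᵗB)` for symplectic `g = (A B; C D)`
(printed as `I − (−2BᵗC 2BᵗA; 2CᵗD −2CᵗA)`; its lower-right block is `1 + 2CᵗB = ᵗ(1 + 2BᵗC)`).
[cite: GoreskyTai2003RealModuli, §4.3 (4.3)] -/
theorem conjK_mul_coe_inv_eq_fromBlocks {R : Type*} [CommRing R] (γ : Matrix.symplecticGroup (Fin g) R) :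
    Matrix.fromBlocks (-1 : Matrix (Fin g) (Fin g) R) 0 0 (1 : Matrix (Fin g) (Fin g) R) *
        (γ : Matrix (Fin g ⊕ Fin g) (Fin g ⊕ Fin g) R) *
        Matrix.fromBlocks (-1 : Matrix (Fin g) (Fin g) R) 0 0 (1 : Matrix (Fin g) (Fin g) R) *
        ((γ⁻¹ : Matrix.symplecticGroup (Fin g) R) : Matrix (Fin g ⊕ Fin g) (Fin g ⊕ Fin g) R) =
      Matrix.fromBlocks
        (1 + (2 : R) • ((γ : Matrix (Fin g ⊕ Fin g) (Fin g ⊕ Fin g) R).toBlocks₁₂ *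
          (γ : Matrix (Fin g ⊕ Fin g) (Fin g ⊕ Fin g) R).toBlocks₂₁ᵀ))
        (-((2 : R) • ((γ : Matrix (Fin g ⊕ Fin g) (Fin g ⊕ Fin g) R).toBlocks₁₂ *
          (γ : Matrix (Fin g ⊕ Fin g) (Fin g ⊕ Fin g) R).toBlocks₁₁ᵀ)))
        (-((2 : R) • ((γ : Matrix (Fin g ⊕ Fin g) (Fin g ⊕ Fin g) R).toBlocks₂₁ *
          (γ : Matrix (Fin g ⊕ Fin g) (Fin g ⊕ Fin g) R).toBlocks₂₂ᵀ)))
        (1 + (2 : R) • ((γ : Matrix (Fin g ⊕ Fin g) (Fin g ⊕ Fin g) R).toBlocks₂₁ *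
          (γ : Matrix (Fin g ⊕ Fin g) (Fin g ⊕ Fin g) R).toBlocks₁₂ᵀ)) := by
  obtain ⟨h1, h2, h3⟩ := toBlocks_mul_transpose_rel γ
  rw [coe_inv_eq_fromBlocks]
  set A := (γ : Matrix (Fin g ⊕ Fin g) (Fin g ⊕ Fin g) R).toBlocks₁₁ with hA
  set B := (γ : Matrix (Fin g ⊕ Fin g) (Fin g ⊕ Fin g) R).toBlocks₁₂ with hB
  set C := (γ : Matrix (Fin g ⊕ Fin g) (Fin g ⊕ Fin g) R).toBlocks₂₁ with hC
  set D := (γ : Matrix (Fin g ⊕ Fin g) (Fin g ⊕ Fin g) R).toBlocks₂₂ with hD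
  have hγ : (γ : Matrix (Fin g ⊕ Fin g) (Fin g ⊕ Fin g) R) = Matrix.fromBlocks A B C D := by
    rw [hA, hB, hC, hD, Matrix.fromBlocks_toBlocks]
  have h3' : A * Dᵀ = 1 + B * Cᵀ := eq_add_of_sub_eq h3
  have h4 : D * Aᵀ = 1 + C * Bᵀ := by
    have := congrArg Matrix.transpose h3'
    rwa [Matrix.transpose_mul, Matrix.transpose_transpose, Matrix.transpose_add, Matrix.transpose_one,
      Matrix.transpose_mul, Matrix.transpose_transpose] at this
  rw [hγ, iStar_mul_fromBlocks_mul_iStar, Matrix.fromBlocks_multiply]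
  simp only [Matrix.neg_mul, Matrix.mul_neg, neg_neg]
  rw [h3', h1, ← h2, h4]
  congr 1
  · rw [two_smul, add_assoc]
  · rw [two_smul, neg_add]
  · rw [two_smul, neg_add]
  · rw [two_smul, add_left_comm]

/-- **Halving a congruence**: `2X ≡ 0 (mod 4m) ⟺ X ≡ 0 (mod 2m)` for an integral matrix `X` (any `m`).
[cite: GoreskyTai2003RealModuli, §4.3 («so that `BᵗC ≡ BᵗA ≡ CᵗD ≡ 0 (mod 2m)`»)] -/
theorem map_two_smul_eq_zero_iff {m : ℕ} (X : Matrix (Fin g) (Fin g) ℤ) :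
    ((2 : ℤ) • X).map (Int.castRingHom (ZMod (4 * m))) = 0 ↔ X.map (Int.castRingHom (ZMod (2 * m))) = 0 := by
  simp only [← Matrix.ext_iff, Matrix.map_apply, Matrix.smul_apply, Matrix.zero_apply, eq_intCast, smul_eq_mul,
    ZMod.intCast_zmod_eq_zero_iff_dvd]
  refine forall_congr' fun i ↦ forall_congr' fun j ↦ ?_
  push_cast
  rw [show (4 : ℤ) * m = 2 * (2 * m) by ring]
  exact mul_dvd_mul_iff_left two_ne_zero

/-- `X ≡ 0 (mod 2m) ⟹ X ≡ 0 (mod 2)`. [cite: GoreskyTai2003RealModuli, §4.3 («since `CᵗB ≡ 0 (mod (2m))` … we see that `AᵗD ≡ I (mod 2)`»)] -/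
theorem map_zmod_two_eq_zero_of_map_eq_zero {m : ℕ} {X : Matrix (Fin g) (Fin g) ℤ}
    (h : X.map (Int.castRingHom (ZMod (2 * m))) = 0) : X.map (Int.castRingHom (ZMod 2)) = 0 := by
  ext i j
  have hij := congr_fun (congr_fun h i) j
  rw [Matrix.map_apply, Matrix.zero_apply, eq_intCast, ZMod.intCast_zmod_eq_zero_iff_dvd] at hij ⊢
  push_cast at hij ⊢
  exact (dvd_mul_right 2 (m : ℤ)).trans hij

/-- `(1 + X) mod q = 1 + X mod q`. [folklore] -/
private theorem map_one_add_g52d {q : ℕ} (X : Matrix (Fin g) (Fin g) ℤ) :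
    (1 + X).map (Int.castRingHom (ZMod q)) = 1 + X.map (Int.castRingHom (ZMod q)) := by
  rw [Matrix.map_add _ (map_add (Int.castRingHom (ZMod q))),
    Matrix.map_one _ (map_zero (Int.castRingHom (ZMod q))) (map_one (Int.castRingHom (ZMod q)))]

/-- `(−X) mod q = −(X mod q)`. [folklore] -/
private theorem map_neg_g52d {q : ℕ} (X : Matrix (Fin g) (Fin g) ℤ) :
    (-X).map (Int.castRingHom (ZMod q)) = -X.map (Int.castRingHom (ZMod q)) :=
  Matrix.map_neg _ (map_neg (Int.castRingHom (ZMod q))) X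

/-- In `ℤ/2` the only unit is `1`. [folklore] -/
private theorem eq_one_of_mul_eq_one_zmod_two_g52d (x y : ZMod 2) (h : x * y = 1) : x = 1 := by
  revert x y
  decide

/-! ## §2 LEMMA 9 (3): `τ(g)g⁻¹ ∈ Γ(4m) ⟹ g = βu`, `β ∈ Γ_{2m}(2)`, `u = (U 0; 0 ᵗU⁻¹)` -/

/-- `(U 0; 0 ᵗU⁻¹) ∈ Sp_{2g}(ℤ)` for `U ∈ SL(g, ℤ)` (the embedding `GL(n) ↪ Sp`, `A ↦ (A 0; 0 ᵗA⁻¹)`).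
[cite: GoreskyTai2003RealModuli, §2.1 («the embedding `A ↦ (A 0; 0 ᵗA⁻¹)`») and §4.3 («Let `u = (U 0; 0 ᵗU⁻¹) ∈ Sp`»)] -/
theorem fromBlocks_specialLinearGroup_mem_symplecticGroup (U : Matrix.SpecialLinearGroup (Fin g) ℤ) :
    Matrix.fromBlocks (U : Matrix (Fin g) (Fin g) ℤ) 0 0
        ((U⁻¹ : Matrix.SpecialLinearGroup (Fin g) ℤ) : Matrix (Fin g) (Fin g) ℤ)ᵀ ∈
      Matrix.symplecticGroup (Fin g) ℤ := by
  rw [SymplecticGroup.fromBlocks_mem_iff]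
  refine ⟨by simp, by simp, ?_⟩
  rw [Matrix.transpose_zero, Matrix.zero_mul, sub_zero, ← Matrix.transpose_mul, ← Matrix.SpecialLinearGroup.coe_mul,
    inv_mul_cancel, Matrix.SpecialLinearGroup.coe_one, Matrix.transpose_one]

/-- **LEMMA 9 (3) (Goresky–Tai).**  Let `g ∈ Sp_{2g}(ℤ)` with `τ(g)g⁻¹ ∈ Γ(4m)`.  Then `g = βu` where
`β ∈ Γ_{2m}(2)` — its blocks satisfy `A_β ≡ D_β ≡ I (mod 2)`, `B_β ≡ C_β ≡ 0 (mod 2m)` — and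
`u = (U 0; 0 ᵗU⁻¹)` with `U ∈ SL(g, ℤ) ⊂ GL(g, ℤ)`.  Proof as printed: (4.3) gives `BᵗC ≡ BᵗA ≡ CᵗD ≡ 0
(mod 2m)`, so `B = (BᵗA)D − (BᵗC)B ≡ 0` and `ᵗC = ᵗA ᵗ(CᵗD) − ᵗC(BᵗC) ≡ 0 (mod 2m)`; `AᵗD − BᵗC = I` gives
`AᵗD ≡ I (mod 2)`, so `det A ≡ 1` and `A mod 2 ∈ GL(g, ℤ/2) = SL(g, ℤ/2)` lifts to `U ∈ SL(g, ℤ)`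
(Andrianov–Zhuravlev Lemma 3.2 (1)); then `AU⁻¹ ≡ A·adj(A) = det A · I ≡ I`, `DᵗU ≡ ᵗ(AᵗD) ≡ I (mod 2)`, and
`β = gu⁻¹ = (AU⁻¹ BᵗU; CU⁻¹ DᵗU)`.  (Printed for `m ≥ 1`; the statement holds verbatim for `m = 0` too.)
[cite: GoreskyTai2003RealModuli, §4.3 Lemma 9 (3) and its proof] [cite: AndrianovZhuravlev2015, Chap. 3 Lemma 3.2 (1)] -/
theorem exists_eq_mul_fromBlocks_of_conjK_mul_inv_mem_siegelPrincipalGamma {m : ℕ}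
    {γ : Matrix.symplecticGroup (Fin g) ℤ}
    (h : (⟨Matrix.fromBlocks (-1 : Matrix (Fin g) (Fin g) ℤ) 0 0 (1 : Matrix (Fin g) (Fin g) ℤ) *
            (γ : Matrix (Fin g ⊕ Fin g) (Fin g ⊕ Fin g) ℤ) *
            Matrix.fromBlocks (-1 : Matrix (Fin g) (Fin g) ℤ) 0 0 (1 : Matrix (Fin g) (Fin g) ℤ),
          iStar_mul_mul_iStar_mem_symplecticGroup γ.2⟩ : Matrix.symplecticGroup (Fin g) ℤ) * γ⁻¹ ∈
      siegelPrincipalGamma g (4 * m)) :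
    ∃ (β : Matrix.symplecticGroup (Fin g) ℤ) (U : Matrix.SpecialLinearGroup (Fin g) ℤ),
      (β : Matrix (Fin g ⊕ Fin g) (Fin g ⊕ Fin g) ℤ).toBlocks₁₁.map (Int.castRingHom (ZMod 2)) = 1 ∧
      (β : Matrix (Fin g ⊕ Fin g) (Fin g ⊕ Fin g) ℤ).toBlocks₂₂.map (Int.castRingHom (ZMod 2)) = 1 ∧
      (β : Matrix (Fin g ⊕ Fin g) (Fin g ⊕ Fin g) ℤ).toBlocks₁₂.map (Int.castRingHom (ZMod (2 * m))) = 0 ∧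
      (β : Matrix (Fin g ⊕ Fin g) (Fin g ⊕ Fin g) ℤ).toBlocks₂₁.map (Int.castRingHom (ZMod (2 * m))) = 0 ∧
      (γ : Matrix (Fin g ⊕ Fin g) (Fin g ⊕ Fin g) ℤ) =
        β * Matrix.fromBlocks (U : Matrix (Fin g) (Fin g) ℤ) 0 0
          ((U⁻¹ : Matrix.SpecialLinearGroup (Fin g) ℤ) : Matrix (Fin g) (Fin g) ℤ)ᵀ := by
  obtain ⟨-, -, h3⟩ := toBlocks_mul_transpose_rel γ
  obtain ⟨-, -, h3'⟩ := toBlocks_transpose_mul_rel γ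
  -- the hypothesis in block form (equation (4.3)): `BᵗC ≡ BᵗA ≡ CᵗD ≡ 0 (mod 2m)`
  rw [mem_siegelPrincipalGamma_iff] at h
  change (Matrix.fromBlocks (-1 : Matrix (Fin g) (Fin g) ℤ) 0 0 (1 : Matrix (Fin g) (Fin g) ℤ) *
        (γ : Matrix (Fin g ⊕ Fin g) (Fin g ⊕ Fin g) ℤ) *
        Matrix.fromBlocks (-1 : Matrix (Fin g) (Fin g) ℤ) 0 0 (1 : Matrix (Fin g) (Fin g) ℤ) *
        ((γ⁻¹ : Matrix.symplecticGroup (Fin g) ℤ) : Matrix (Fin g ⊕ Fin g) (Fin g ⊕ Fin g) ℤ)).map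
      (Int.castRingHom (ZMod (4 * m))) = 1 at h
  rw [conjK_mul_coe_inv_eq_fromBlocks, Matrix.fromBlocks_map, ← Matrix.fromBlocks_one, Matrix.fromBlocks_inj] at h
  obtain ⟨hBC, hBA, hCD, -⟩ := h
  rw [map_one_add_g52d, add_eq_left, map_two_smul_eq_zero_iff] at hBC
  rw [map_neg_g52d, neg_eq_zero, map_two_smul_eq_zero_iff] at hBA
  rw [map_neg_g52d, neg_eq_zero, map_two_smul_eq_zero_iff] at hCD
  set A := (γ : Matrix (Fin g ⊕ Fin g) (Fin g ⊕ Fin g) ℤ).toBlocks₁₁ with hA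
  set B := (γ : Matrix (Fin g ⊕ Fin g) (Fin g ⊕ Fin g) ℤ).toBlocks₁₂ with hB
  set C := (γ : Matrix (Fin g ⊕ Fin g) (Fin g ⊕ Fin g) ℤ).toBlocks₂₁ with hC
  set D := (γ : Matrix (Fin g ⊕ Fin g) (Fin g ⊕ Fin g) ℤ).toBlocks₂₂ with hD
  have hγ : (γ : Matrix (Fin g ⊕ Fin g) (Fin g ⊕ Fin g) ℤ) = Matrix.fromBlocks A B C D := by
    rw [hA, hB, hC, hD, Matrix.fromBlocks_toBlocks]
  -- `B ≡ 0 (mod 2m)` and `C ≡ 0 (mod 2m)`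
  have hB0 : B.map (Int.castRingHom (ZMod (2 * m))) = 0 := by
    have e : B = B * Aᵀ * D - B * Cᵀ * B := by
      calc B = B * (Aᵀ * D - Cᵀ * B) := by rw [h3', Matrix.mul_one]
        _ = B * Aᵀ * D - B * Cᵀ * B := by rw [Matrix.mul_sub, Matrix.mul_assoc, Matrix.mul_assoc]
    rw [e, Matrix.map_sub _ (map_sub (Int.castRingHom (ZMod (2 * m)))), Matrix.map_mul (L := B * Aᵀ),
      Matrix.map_mul (L := B * Cᵀ), hBA, hBC, Matrix.zero_mul, Matrix.zero_mul, sub_zero]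
  have hC0 : C.map (Int.castRingHom (ZMod (2 * m))) = 0 := by
    have e : Cᵀ = Aᵀ * (C * Dᵀ)ᵀ - Cᵀ * (B * Cᵀ) := by
      calc Cᵀ = (Aᵀ * D - Cᵀ * B) * Cᵀ := by rw [h3', Matrix.one_mul]
        _ = Aᵀ * (C * Dᵀ)ᵀ - Cᵀ * (B * Cᵀ) := by
          rw [Matrix.sub_mul, Matrix.mul_assoc, Matrix.mul_assoc, Matrix.transpose_mul, Matrix.transpose_transpose]
    have hCt : Cᵀ.map (Int.castRingHom (ZMod (2 * m))) = 0 := by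
      rw [e, Matrix.map_sub _ (map_sub (Int.castRingHom (ZMod (2 * m)))), Matrix.map_mul (L := Aᵀ),
        Matrix.map_mul (L := Cᵀ), Matrix.transpose_map (M := C * Dᵀ), hCD, hBC, Matrix.transpose_zero,
        Matrix.mul_zero, Matrix.mul_zero, sub_zero]
    rwa [Matrix.transpose_map, Matrix.transpose_eq_zero] at hCt
  -- `AᵗD ≡ I (mod 2)`, hence `det A ≡ 1 (mod 2)`
  have hAD2 : A.map (Int.castRingHom (ZMod 2)) * (D.map (Int.castRingHom (ZMod 2)))ᵀ = 1 := by
    have := congrArg (fun X : Matrix (Fin g) (Fin g) ℤ ↦ X.map (Int.castRingHom (ZMod 2))) h3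
    simpa only [Matrix.map_sub _ (map_sub (Int.castRingHom (ZMod 2))), Matrix.map_mul, Matrix.transpose_map,
      map_zmod_two_eq_zero_of_map_eq_zero hB0, Matrix.zero_mul, sub_zero,
      Matrix.map_one _ (map_zero (Int.castRingHom (ZMod 2))) (map_one (Int.castRingHom (ZMod 2)))] using this
  have hdet : (A.map (Int.castRingHom (ZMod 2))).det = 1 := by
    have hu : (A.map (Int.castRingHom (ZMod 2))).det * ((D.map (Int.castRingHom (ZMod 2)))ᵀ).det = 1 := by
      rw [← Matrix.det_mul, hAD2, Matrix.det_one]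
    exact eq_one_of_mul_eq_one_zmod_two_g52d _ _ hu
  -- lift `A mod 2 ∈ SL(g, ℤ/2)` to `U ∈ SL(g, ℤ)`
  obtain ⟨U, hU⟩ := exists_specialLinearGroup_map_intCast_eq 2 ⟨A.map (Int.castRingHom (ZMod 2)), hdet⟩
  have hUA : (U : Matrix (Fin g) (Fin g) ℤ).map (Int.castRingHom (ZMod 2)) = A.map (Int.castRingHom (ZMod 2)) := by
    have := congrArg Subtype.val hU
    simpa only [Matrix.SpecialLinearGroup.map_apply_coe, RingHom.mapMatrix_apply] using this
  have hU'U : ((U⁻¹ : Matrix.SpecialLinearGroup (Fin g) ℤ) : Matrix (Fin g) (Fin g) ℤ) * (U : Matrix (Fin g) (Fin g) ℤ) = 1 := by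
    rw [← Matrix.SpecialLinearGroup.coe_mul, inv_mul_cancel, Matrix.SpecialLinearGroup.coe_one]
  -- `u⁻¹ = (U⁻¹ 0; 0 ᵗU)` is symplectic, and `β = gu⁻¹ = (AU⁻¹ BᵗU; CU⁻¹ DᵗU)`
  have hu'mem : Matrix.fromBlocks ((U⁻¹ : Matrix.SpecialLinearGroup (Fin g) ℤ) : Matrix (Fin g) (Fin g) ℤ) 0 0
      (U : Matrix (Fin g) (Fin g) ℤ)ᵀ ∈ Matrix.symplecticGroup (Fin g) ℤ := by
    have := fromBlocks_specialLinearGroup_mem_symplecticGroup U⁻¹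
    rwa [inv_inv] at this
  have hβ : (γ : Matrix (Fin g ⊕ Fin g) (Fin g ⊕ Fin g) ℤ) *
      Matrix.fromBlocks ((U⁻¹ : Matrix.SpecialLinearGroup (Fin g) ℤ) : Matrix (Fin g) (Fin g) ℤ) 0 0
        (U : Matrix (Fin g) (Fin g) ℤ)ᵀ =
      Matrix.fromBlocks (A * ((U⁻¹ : Matrix.SpecialLinearGroup (Fin g) ℤ) : Matrix (Fin g) (Fin g) ℤ))
        (B * (U : Matrix (Fin g) (Fin g) ℤ)ᵀ)
        (C * ((U⁻¹ : Matrix.SpecialLinearGroup (Fin g) ℤ) : Matrix (Fin g) (Fin g) ℤ))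
        (D * (U : Matrix (Fin g) (Fin g) ℤ)ᵀ) := by
    rw [hγ, Matrix.fromBlocks_multiply]
    simp only [Matrix.mul_zero, add_zero, zero_add]
  have hmem : Matrix.fromBlocks (A * ((U⁻¹ : Matrix.SpecialLinearGroup (Fin g) ℤ) : Matrix (Fin g) (Fin g) ℤ))
        (B * (U : Matrix (Fin g) (Fin g) ℤ)ᵀ)
        (C * ((U⁻¹ : Matrix.SpecialLinearGroup (Fin g) ℤ) : Matrix (Fin g) (Fin g) ℤ))
        (D * (U : Matrix (Fin g) (Fin g) ℤ)ᵀ) ∈ Matrix.symplecticGroup (Fin g) ℤ := by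
    rw [← hβ]
    exact Submonoid.mul_mem _ γ.2 hu'mem
  have hadj : (Matrix.adjugate (U : Matrix (Fin g) (Fin g) ℤ)).map (Int.castRingHom (ZMod 2)) =
      Matrix.adjugate (A.map (Int.castRingHom (ZMod 2))) := by
    rw [← RingHom.mapMatrix_apply, RingHom.map_adjugate, RingHom.mapMatrix_apply, hUA]
  refine ⟨⟨_, hmem⟩, U, ?_, ?_, ?_, ?_, ?_⟩
  · show (Matrix.fromBlocks (A * ((U⁻¹ : Matrix.SpecialLinearGroup (Fin g) ℤ) : Matrix (Fin g) (Fin g) ℤ)) _ _ _).toBlocks₁₁.map _ = 1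
    rw [Matrix.toBlocks_fromBlocks₁₁, Matrix.map_mul, Matrix.SpecialLinearGroup.coe_inv, hadj, Matrix.mul_adjugate,
      hdet, one_smul]
  · show (Matrix.fromBlocks (A * ((U⁻¹ : Matrix.SpecialLinearGroup (Fin g) ℤ) : Matrix (Fin g) (Fin g) ℤ)) _ _ _).toBlocks₂₂.map _ = 1
    rw [Matrix.toBlocks_fromBlocks₂₂, Matrix.map_mul, Matrix.transpose_map, hUA]
    have := congrArg Matrix.transpose hAD2
    rwa [Matrix.transpose_mul, Matrix.transpose_transpose, Matrix.transpose_one] at this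
  · show (Matrix.fromBlocks (A * ((U⁻¹ : Matrix.SpecialLinearGroup (Fin g) ℤ) : Matrix (Fin g) (Fin g) ℤ)) _ _ _).toBlocks₁₂.map _ = 0
    rw [Matrix.toBlocks_fromBlocks₁₂, Matrix.map_mul, hB0, Matrix.zero_mul]
  · show (Matrix.fromBlocks (A * ((U⁻¹ : Matrix.SpecialLinearGroup (Fin g) ℤ) : Matrix (Fin g) (Fin g) ℤ)) _ _ _).toBlocks₂₁.map _ = 0
    rw [Matrix.toBlocks_fromBlocks₂₁, Matrix.map_mul, hC0, Matrix.zero_mul]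
  · show (γ : Matrix (Fin g ⊕ Fin g) (Fin g ⊕ Fin g) ℤ) = Matrix.fromBlocks _ _ _ _ * _
    rw [← hβ, Matrix.mul_assoc, Matrix.fromBlocks_multiply]
    simp only [Matrix.mul_zero, Matrix.zero_mul, add_zero, zero_add]
    rw [hU'U, ← Matrix.transpose_mul, hU'U, Matrix.transpose_one, Matrix.fromBlocks_one, Matrix.mul_one]

/-! ## §3 The converse: `β ∈ Γ_{2m}(2)`, `u` block diagonal ⟹ `τ(βu)(βu)⁻¹ = τ(β)β⁻¹ ∈ Γ(4m)` -/

/-- `B_β ≡ C_β ≡ 0 (mod 2m) ⟹ τ(β)β⁻¹ ∈ Γ(4m)` («which is easily seen (using (4.3)) to lie in `Γ(4m)`»; the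
congruences on `A_β`, `D_β` are not needed for this direction).
[cite: GoreskyTai2003RealModuli, §4.3 Lemma 9 (3), proof of the converse] -/
theorem conjK_mul_inv_mem_siegelPrincipalGamma_of_toBlocks {m : ℕ} {β : Matrix.symplecticGroup (Fin g) ℤ}
    (hB : (β : Matrix (Fin g ⊕ Fin g) (Fin g ⊕ Fin g) ℤ).toBlocks₁₂.map (Int.castRingHom (ZMod (2 * m))) = 0)
    (hC : (β : Matrix (Fin g ⊕ Fin g) (Fin g ⊕ Fin g) ℤ).toBlocks₂₁.map (Int.castRingHom (ZMod (2 * m))) = 0) :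
    (⟨Matrix.fromBlocks (-1 : Matrix (Fin g) (Fin g) ℤ) 0 0 (1 : Matrix (Fin g) (Fin g) ℤ) *
            (β : Matrix (Fin g ⊕ Fin g) (Fin g ⊕ Fin g) ℤ) *
            Matrix.fromBlocks (-1 : Matrix (Fin g) (Fin g) ℤ) 0 0 (1 : Matrix (Fin g) (Fin g) ℤ),
          iStar_mul_mul_iStar_mem_symplecticGroup β.2⟩ : Matrix.symplecticGroup (Fin g) ℤ) * β⁻¹ ∈
      siegelPrincipalGamma g (4 * m) := by
  have hz : ∀ X Y : Matrix (Fin g) (Fin g) ℤ, X.map (Int.castRingHom (ZMod (2 * m))) = 0 →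
      ((2 : ℤ) • (X * Y)).map (Int.castRingHom (ZMod (4 * m))) = 0 := fun X Y hX ↦ by
    rw [map_two_smul_eq_zero_iff, Matrix.map_mul, hX, Matrix.zero_mul]
  rw [mem_siegelPrincipalGamma_iff]
  change (Matrix.fromBlocks (-1 : Matrix (Fin g) (Fin g) ℤ) 0 0 (1 : Matrix (Fin g) (Fin g) ℤ) *
        (β : Matrix (Fin g ⊕ Fin g) (Fin g ⊕ Fin g) ℤ) *
        Matrix.fromBlocks (-1 : Matrix (Fin g) (Fin g) ℤ) 0 0 (1 : Matrix (Fin g) (Fin g) ℤ) *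
        ((β⁻¹ : Matrix.symplecticGroup (Fin g) ℤ) : Matrix (Fin g ⊕ Fin g) (Fin g ⊕ Fin g) ℤ)).map
      (Int.castRingHom (ZMod (4 * m))) = 1
  rw [conjK_mul_coe_inv_eq_fromBlocks, Matrix.fromBlocks_map, ← Matrix.fromBlocks_one, map_one_add_g52d,
    map_one_add_g52d, map_neg_g52d, map_neg_g52d, hz _ _ hB, hz _ _ hB, hz _ _ hC, hz _ _ hC, add_zero, neg_zero]

/-- **`τ(βu)(βu)⁻¹ = τ(β)β⁻¹` for block-diagonal `u = (P 0; 0 Q) ∈ Sp_{2g}(ℤ)`** (because `τ(u) = u`; the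
block-diagonal elements of `Sp_{2g}(ℤ)` are exactly the embedded `GL(g, ℤ)`, `Q = ᵗP⁻¹`).
[cite: GoreskyTai2003RealModuli, §4.3 («if `β ∈ Γ_{2m}(2)` and `u ∈ GL(n, ℤ)` then `τ(βu)(βu)⁻¹ = β̃β⁻¹`») and §2.2 («`τ(g) = g ⟺ g ∈ GL(n, ℝ)`»)] -/
theorem conjK_mul_inv_mul_eq_of_coe_eq_fromBlocks (β u : Matrix.symplecticGroup (Fin g) ℤ)
    {P Q : Matrix (Fin g) (Fin g) ℤ} (hu : (u : Matrix (Fin g ⊕ Fin g) (Fin g ⊕ Fin g) ℤ) = Matrix.fromBlocks P 0 0 Q) :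
    (⟨Matrix.fromBlocks (-1 : Matrix (Fin g) (Fin g) ℤ) 0 0 (1 : Matrix (Fin g) (Fin g) ℤ) *
            ((β * u : Matrix.symplecticGroup (Fin g) ℤ) : Matrix (Fin g ⊕ Fin g) (Fin g ⊕ Fin g) ℤ) *
            Matrix.fromBlocks (-1 : Matrix (Fin g) (Fin g) ℤ) 0 0 (1 : Matrix (Fin g) (Fin g) ℤ),
          iStar_mul_mul_iStar_mem_symplecticGroup (β * u).2⟩ : Matrix.symplecticGroup (Fin g) ℤ) * (β * u)⁻¹ =
      (⟨Matrix.fromBlocks (-1 : Matrix (Fin g) (Fin g) ℤ) 0 0 (1 : Matrix (Fin g) (Fin g) ℤ) *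
            (β : Matrix (Fin g ⊕ Fin g) (Fin g ⊕ Fin g) ℤ) *
            Matrix.fromBlocks (-1 : Matrix (Fin g) (Fin g) ℤ) 0 0 (1 : Matrix (Fin g) (Fin g) ℤ),
          iStar_mul_mul_iStar_mem_symplecticGroup β.2⟩ : Matrix.symplecticGroup (Fin g) ℤ) * β⁻¹ := by
  -- `τ(u) = u`
  have hfix : Matrix.fromBlocks (-1 : Matrix (Fin g) (Fin g) ℤ) 0 0 (1 : Matrix (Fin g) (Fin g) ℤ) * (u : Matrix (Fin g ⊕ Fin g) (Fin g ⊕ Fin g) ℤ) *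
      Matrix.fromBlocks (-1 : Matrix (Fin g) (Fin g) ℤ) 0 0 (1 : Matrix (Fin g) (Fin g) ℤ) = (u : Matrix (Fin g ⊕ Fin g) (Fin g ⊕ Fin g) ℤ) := by
    rw [hu, iStar_mul_fromBlocks_mul_iStar, neg_zero]
  -- `τ(βu) = τ(β) u`
  have hτ : (⟨Matrix.fromBlocks (-1 : Matrix (Fin g) (Fin g) ℤ) 0 0 (1 : Matrix (Fin g) (Fin g) ℤ) *
            ((β * u : Matrix.symplecticGroup (Fin g) ℤ) : Matrix (Fin g ⊕ Fin g) (Fin g ⊕ Fin g) ℤ) *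
            Matrix.fromBlocks (-1 : Matrix (Fin g) (Fin g) ℤ) 0 0 (1 : Matrix (Fin g) (Fin g) ℤ),
          iStar_mul_mul_iStar_mem_symplecticGroup (β * u).2⟩ : Matrix.symplecticGroup (Fin g) ℤ) =
      (⟨Matrix.fromBlocks (-1 : Matrix (Fin g) (Fin g) ℤ) 0 0 (1 : Matrix (Fin g) (Fin g) ℤ) *
            (β : Matrix (Fin g ⊕ Fin g) (Fin g ⊕ Fin g) ℤ) *
            Matrix.fromBlocks (-1 : Matrix (Fin g) (Fin g) ℤ) 0 0 (1 : Matrix (Fin g) (Fin g) ℤ),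
          iStar_mul_mul_iStar_mem_symplecticGroup β.2⟩ : Matrix.symplecticGroup (Fin g) ℤ) * u := by
    apply Subtype.ext
    change Matrix.fromBlocks (-1 : Matrix (Fin g) (Fin g) ℤ) 0 0 (1 : Matrix (Fin g) (Fin g) ℤ) *
        ((β : Matrix (Fin g ⊕ Fin g) (Fin g ⊕ Fin g) ℤ) * (u : Matrix (Fin g ⊕ Fin g) (Fin g ⊕ Fin g) ℤ)) *
        Matrix.fromBlocks (-1 : Matrix (Fin g) (Fin g) ℤ) 0 0 (1 : Matrix (Fin g) (Fin g) ℤ) =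
      Matrix.fromBlocks (-1 : Matrix (Fin g) (Fin g) ℤ) 0 0 (1 : Matrix (Fin g) (Fin g) ℤ) *
        (β : Matrix (Fin g ⊕ Fin g) (Fin g ⊕ Fin g) ℤ) *
        Matrix.fromBlocks (-1 : Matrix (Fin g) (Fin g) ℤ) 0 0 (1 : Matrix (Fin g) (Fin g) ℤ) * (u : Matrix (Fin g ⊕ Fin g) (Fin g ⊕ Fin g) ℤ)
    calc Matrix.fromBlocks (-1 : Matrix (Fin g) (Fin g) ℤ) 0 0 (1 : Matrix (Fin g) (Fin g) ℤ) *
          ((β : Matrix (Fin g ⊕ Fin g) (Fin g ⊕ Fin g) ℤ) * (u : Matrix (Fin g ⊕ Fin g) (Fin g ⊕ Fin g) ℤ)) *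
          Matrix.fromBlocks (-1 : Matrix (Fin g) (Fin g) ℤ) 0 0 (1 : Matrix (Fin g) (Fin g) ℤ)
        = Matrix.fromBlocks (-1 : Matrix (Fin g) (Fin g) ℤ) 0 0 (1 : Matrix (Fin g) (Fin g) ℤ) *
            (β : Matrix (Fin g ⊕ Fin g) (Fin g ⊕ Fin g) ℤ) *
            (Matrix.fromBlocks (-1 : Matrix (Fin g) (Fin g) ℤ) 0 0 (1 : Matrix (Fin g) (Fin g) ℤ) *
              Matrix.fromBlocks (-1 : Matrix (Fin g) (Fin g) ℤ) 0 0 (1 : Matrix (Fin g) (Fin g) ℤ)) *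
            (u : Matrix (Fin g ⊕ Fin g) (Fin g ⊕ Fin g) ℤ) *
            Matrix.fromBlocks (-1 : Matrix (Fin g) (Fin g) ℤ) 0 0 (1 : Matrix (Fin g) (Fin g) ℤ) := by
          rw [iStar_mul_iStar, Matrix.mul_one, ← Matrix.mul_assoc]
      _ = Matrix.fromBlocks (-1 : Matrix (Fin g) (Fin g) ℤ) 0 0 (1 : Matrix (Fin g) (Fin g) ℤ) *
            (β : Matrix (Fin g ⊕ Fin g) (Fin g ⊕ Fin g) ℤ) *
            Matrix.fromBlocks (-1 : Matrix (Fin g) (Fin g) ℤ) 0 0 (1 : Matrix (Fin g) (Fin g) ℤ) *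
            (Matrix.fromBlocks (-1 : Matrix (Fin g) (Fin g) ℤ) 0 0 (1 : Matrix (Fin g) (Fin g) ℤ) * (u : Matrix (Fin g ⊕ Fin g) (Fin g ⊕ Fin g) ℤ) *
              Matrix.fromBlocks (-1 : Matrix (Fin g) (Fin g) ℤ) 0 0 (1 : Matrix (Fin g) (Fin g) ℤ)) := by
          simp only [Matrix.mul_assoc]
      _ = Matrix.fromBlocks (-1 : Matrix (Fin g) (Fin g) ℤ) 0 0 (1 : Matrix (Fin g) (Fin g) ℤ) *
            (β : Matrix (Fin g ⊕ Fin g) (Fin g ⊕ Fin g) ℤ) *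
            Matrix.fromBlocks (-1 : Matrix (Fin g) (Fin g) ℤ) 0 0 (1 : Matrix (Fin g) (Fin g) ℤ) * (u : Matrix (Fin g ⊕ Fin g) (Fin g ⊕ Fin g) ℤ) := by rw [hfix]
  rw [hτ, _root_.mul_inv_rev, ← mul_assoc, mul_inv_cancel_right]

/-- **LEMMA 9 (3), converse, as printed**: «if `β ∈ Γ_{2m}(2)` and `u ∈ GL(n, ℤ)` then
`τ(βu)(βu)⁻¹ = β̃β⁻¹` which is easily seen (using (4.3)) to lie in `Γ(4m)`» — here for any `β ∈ Sp_{2g}(ℤ)` with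
`B_β ≡ C_β ≡ 0 (mod 2m)` and any block-diagonal `u = (P 0; 0 Q) ∈ Sp_{2g}(ℤ)` (`= GL(g, ℤ) ↪ Sp`, e.g.
`u = (U 0; 0 ᵗU⁻¹)`). [cite: GoreskyTai2003RealModuli, §4.3 Lemma 9 (3), converse] -/
theorem conjK_mul_inv_mem_siegelPrincipalGamma_of_toBlocks_of_coe_eq_fromBlocks {m : ℕ}
    {β : Matrix.symplecticGroup (Fin g) ℤ}
    (hB : (β : Matrix (Fin g ⊕ Fin g) (Fin g ⊕ Fin g) ℤ).toBlocks₁₂.map (Int.castRingHom (ZMod (2 * m))) = 0)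
    (hC : (β : Matrix (Fin g ⊕ Fin g) (Fin g ⊕ Fin g) ℤ).toBlocks₂₁.map (Int.castRingHom (ZMod (2 * m))) = 0)
    (u : Matrix.symplecticGroup (Fin g) ℤ) {P Q : Matrix (Fin g) (Fin g) ℤ}
    (hu : (u : Matrix (Fin g ⊕ Fin g) (Fin g ⊕ Fin g) ℤ) = Matrix.fromBlocks P 0 0 Q) :
    (⟨Matrix.fromBlocks (-1 : Matrix (Fin g) (Fin g) ℤ) 0 0 (1 : Matrix (Fin g) (Fin g) ℤ) *
            ((β * u : Matrix.symplecticGroup (Fin g) ℤ) : Matrix (Fin g ⊕ Fin g) (Fin g ⊕ Fin g) ℤ) *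
            Matrix.fromBlocks (-1 : Matrix (Fin g) (Fin g) ℤ) 0 0 (1 : Matrix (Fin g) (Fin g) ℤ),
          iStar_mul_mul_iStar_mem_symplecticGroup (β * u).2⟩ : Matrix.symplecticGroup (Fin g) ℤ) * (β * u)⁻¹ ∈
      siegelPrincipalGamma g (4 * m) := by
  rw [conjK_mul_inv_mul_eq_of_coe_eq_fromBlocks β u hu]
  exact conjK_mul_inv_mem_siegelPrincipalGamma_of_toBlocks hB hC

/-! ## §4 COROLLARY 11 as printed -/

/-- **COROLLARY 11 (Goresky–Tai).**  «Suppose `γ ∈ Γ(4m)` and `𝔥_n^γ ≠ ∅`.  Then there exists `g ∈ Γ_{2m}(2)`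
such that `γ = g̃g⁻¹` (hence `𝔥_n^γ = giC_n`).»  Here, for `g ≥ 1` and `m ≥ 1`: there is `β ∈ Sp_{2g}(ℤ)` with
`A_β ≡ D_β ≡ I (mod 2)`, `B_β ≡ C_β ≡ 0 (mod 2m)` (i.e. `β ∈ Γ_{2m}(2)`), `γ = τ(β)β⁻¹` in `Sp_{2g}(ℤ)`, and
`γ • Ω = τΩ ⟺ Re(β⁻¹ • Ω) = 0` for every `Ω ∈ 𝔥_g`.  Proof as printed: g52-#3 (Prop. 1, a generic point of the
real locus, Prop. 10) gives an integral `h` with `γ = τ(h)h⁻¹`; Lemma 9 (3) gives `h = βu`; and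
`τ(βu)(βu)⁻¹ = τ(β)β⁻¹`, whose real locus is `β · iC_g` (g51-#5).
[cite: GoreskyTai2003RealModuli, §4.4 Cor. 11 and its proof] -/
theorem exists_gammaTwoM_eq_conjK_mul_inv_of_mem_siegelPrincipalGamma_four_mul (hg : 0 < g) {m : ℕ}
    (hm : 0 < m) {γ : Matrix.symplecticGroup (Fin g) ℤ} (hγ : γ ∈ siegelPrincipalGamma g (4 * m))
    (hreal : ∃ Ω : siegelUpperHalfSpace g, symplecticIntHom g γ • Ω =
      ⟨-(Ω : Matrix (Fin g) (Fin g) ℂ).map conj, neg_map_conj_mem_siegelUpperHalfSpace Ω.2⟩) :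
    ∃ β : Matrix.symplecticGroup (Fin g) ℤ,
      ((β : Matrix (Fin g ⊕ Fin g) (Fin g ⊕ Fin g) ℤ).toBlocks₁₁.map (Int.castRingHom (ZMod 2)) = 1 ∧
        (β : Matrix (Fin g ⊕ Fin g) (Fin g ⊕ Fin g) ℤ).toBlocks₂₂.map (Int.castRingHom (ZMod 2)) = 1 ∧
        (β : Matrix (Fin g ⊕ Fin g) (Fin g ⊕ Fin g) ℤ).toBlocks₁₂.map (Int.castRingHom (ZMod (2 * m))) = 0 ∧
        (β : Matrix (Fin g ⊕ Fin g) (Fin g ⊕ Fin g) ℤ).toBlocks₂₁.map (Int.castRingHom (ZMod (2 * m))) = 0) ∧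
      γ = (⟨Matrix.fromBlocks (-1 : Matrix (Fin g) (Fin g) ℤ) 0 0 (1 : Matrix (Fin g) (Fin g) ℤ) *
              (β : Matrix (Fin g ⊕ Fin g) (Fin g ⊕ Fin g) ℤ) *
              Matrix.fromBlocks (-1 : Matrix (Fin g) (Fin g) ℤ) 0 0 (1 : Matrix (Fin g) (Fin g) ℤ),
            iStar_mul_mul_iStar_mem_symplecticGroup β.2⟩ : Matrix.symplecticGroup (Fin g) ℤ) * β⁻¹ ∧
      ∀ Ω : siegelUpperHalfSpace g,
        symplecticIntHom g γ • Ω = ⟨-(Ω : Matrix (Fin g) (Fin g) ℂ).map conj, neg_map_conj_mem_siegelUpperHalfSpace Ω.2⟩ ↔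
          (((symplecticIntHom g β)⁻¹ • Ω : siegelUpperHalfSpace g) : Matrix (Fin g) (Fin g) ℂ).map Complex.re = 0 := by
  have hq : 3 ≤ 4 * m := by omega
  have hq2 : 2 ∣ 4 * m := ⟨2 * m, by ring⟩
  obtain ⟨h, hhΓ, hγh, -⟩ :=
    exists_mem_siegelModularGroup_eq_iStarConj_mul_inv_of_exists_smul_eq_negConj hg hq hq2 hγ hreal
  obtain ⟨η, rfl⟩ := MonoidHom.mem_range.1 hhΓ
  -- `γ = τ(η)η⁻¹` in `Sp_{2g}(ℤ)`
  have hγη : γ = (⟨Matrix.fromBlocks (-1 : Matrix (Fin g) (Fin g) ℤ) 0 0 (1 : Matrix (Fin g) (Fin g) ℤ) *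
        (η : Matrix (Fin g ⊕ Fin g) (Fin g ⊕ Fin g) ℤ) *
        Matrix.fromBlocks (-1 : Matrix (Fin g) (Fin g) ℤ) 0 0 (1 : Matrix (Fin g) (Fin g) ℤ),
      iStar_mul_mul_iStar_mem_symplecticGroup η.2⟩ : Matrix.symplecticGroup (Fin g) ℤ) * η⁻¹ := by
    apply symplecticIntHom_injective
    rw [map_mul, map_inv, symplecticIntHom_conjK]
    exact hγh
  have hη4 : (⟨Matrix.fromBlocks (-1 : Matrix (Fin g) (Fin g) ℤ) 0 0 (1 : Matrix (Fin g) (Fin g) ℤ) *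
        (η : Matrix (Fin g ⊕ Fin g) (Fin g ⊕ Fin g) ℤ) *
        Matrix.fromBlocks (-1 : Matrix (Fin g) (Fin g) ℤ) 0 0 (1 : Matrix (Fin g) (Fin g) ℤ),
      iStar_mul_mul_iStar_mem_symplecticGroup η.2⟩ : Matrix.symplecticGroup (Fin g) ℤ) * η⁻¹ ∈
      siegelPrincipalGamma g (4 * m) := by
    rw [← hγη]
    exact hγ
  -- Lemma 9 (3): `η = βu`
  obtain ⟨β, U, hA, hD, hB, hC, hηβ⟩ := exists_eq_mul_fromBlocks_of_conjK_mul_inv_mem_siegelPrincipalGamma hη4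
  obtain ⟨u, hu⟩ : ∃ u : Matrix.symplecticGroup (Fin g) ℤ, (u : Matrix (Fin g ⊕ Fin g) (Fin g ⊕ Fin g) ℤ) =
      Matrix.fromBlocks (U : Matrix (Fin g) (Fin g) ℤ) 0 0 ((U⁻¹ : Matrix.SpecialLinearGroup (Fin g) ℤ) : Matrix (Fin g) (Fin g) ℤ)ᵀ :=
    ⟨⟨_, fromBlocks_specialLinearGroup_mem_symplecticGroup U⟩, rfl⟩
  have hη : η = β * u := by
    apply Subtype.ext
    change (η : Matrix (Fin g ⊕ Fin g) (Fin g ⊕ Fin g) ℤ) =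
      (β : Matrix (Fin g ⊕ Fin g) (Fin g ⊕ Fin g) ℤ) * (u : Matrix (Fin g ⊕ Fin g) (Fin g ⊕ Fin g) ℤ)
    rw [hu]
    exact hηβ
  have hγβ : γ = (⟨Matrix.fromBlocks (-1 : Matrix (Fin g) (Fin g) ℤ) 0 0 (1 : Matrix (Fin g) (Fin g) ℤ) *
        (β : Matrix (Fin g ⊕ Fin g) (Fin g ⊕ Fin g) ℤ) *
        Matrix.fromBlocks (-1 : Matrix (Fin g) (Fin g) ℤ) 0 0 (1 : Matrix (Fin g) (Fin g) ℤ),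
      iStar_mul_mul_iStar_mem_symplecticGroup β.2⟩ : Matrix.symplecticGroup (Fin g) ℤ) * β⁻¹ := by
    rw [hγη, hη]
    exact conjK_mul_inv_mul_eq_of_coe_eq_fromBlocks β u hu
  refine ⟨β, ⟨hA, hD, hB, hC⟩, hγβ, fun Ω ↦ ?_⟩
  have hιγ : symplecticIntHom g γ =
      (⟨Matrix.fromBlocks (-1 : Matrix (Fin g) (Fin g) ℝ) 0 0 (1 : Matrix (Fin g) (Fin g) ℝ) *
            ((symplecticIntHom g β : Matrix.symplecticGroup (Fin g) ℝ) : Matrix (Fin g ⊕ Fin g) (Fin g ⊕ Fin g) ℝ) *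
            Matrix.fromBlocks (-1 : Matrix (Fin g) (Fin g) ℝ) 0 0 (1 : Matrix (Fin g) (Fin g) ℝ),
          iStar_mul_mul_iStar_mem_symplecticGroup (symplecticIntHom g β).2⟩ : Matrix.symplecticGroup (Fin g) ℝ) *
        (symplecticIntHom g β)⁻¹ := by
    rw [hγβ, map_mul, map_inv, symplecticIntHom_conjK]
  rw [hιγ]
  exact smul_eq_negConj_iff_of_coboundary (symplecticIntHom g β) Ω

end SiegelModuli

end Literature.AlgebraicGeometry.ModuliOfAbelianVarieties
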